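import Literature.Analysis.FunctionSpaces.SobolevDomainProofs
import HarnessLib

/-!
# Discharged fact: the Poincaré inequality on `W₀^{1,p}(Ω)` (`SobolevDomain`)

`Literature.Analysis.FunctionSpaces.SobolevDomain` records the **Poincaré inequality** on
`W₀^{1,p}(Ω)` as the named fact `Literature.Analysis.FunctionSpaces.poincare_inequality`: for a bounded open `Ω` in a
finite-dimensional real normed space `E'` of positive dimension, `1 ≤ p ≤ ∞`, an additive Haar
measure `μ` and a complete `F`, there is `C` with `‖f‖_{L^p(Ω)} ≤ C ‖g‖_{L^p(Ω)}` for every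
`f ∈ W₀^{1,p}(Ω; F)` with weak derivative `g` (Evans, *PDE*, §5.6.1, Theorem 3, the estimate
`‖u‖_{L^p(U)} ≤ C ‖Du‖_{L^p(U)}` for `u ∈ W₀^{1,p}(U)`, `U` bounded; Brezis, Cor. 9.19). This file
proves it, `Literature.Analysis.FunctionSpaces.poincare_inequality_holds`, with the explicit constant `C = 2ρ` when
`Ω ⊆ closedBall 0 ρ`, together with

* `Literature.Analysis.FunctionSpaces.enorm_le_lintegral_fderiv_line` — `‖φ x‖ ≤ ∫_{[-2ρ,0]} ‖Dφ (x + t v)‖ dt` for `φ ∈ C¹` with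
  `tsupport φ ⊆ closedBall 0 ρ` and a unit vector `v` (fundamental theorem of calculus along a
  line);
* `Literature.Analysis.FunctionSpaces.eLpNorm_le_mul_eLpNorm_fderiv_of_tsupport_subset_closedBall` — the `C¹` case
  `‖φ‖_{L^p(μ)} ≤ 2ρ ‖Dφ‖_{L^p(μ)}`, `1 ≤ p ≤ ∞` (Adams, *Sobolev Spaces* (1975), ¶6.26,
  inequality (31), p. 158, for domains of finite width);
* `Literature.Analysis.FunctionSpaces.eLpNorm_le_card_mul_opNorm_mul_sum_eLpNorm_apply_basis` — the `L^p` norm of an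
  operator-valued map is controlled by the `L^p` norms of its values on a finite basis.

It uses only `Literature.Analysis.FunctionSpaces.HasWeakFDerivOn.of_contDiff_holds`, `Literature.Analysis.FunctionSpaces.HasWeakFDerivOn.unique_holds` and
`Literature.Analysis.FunctionSpaces.HasWeakFDerivOn.sub` from `Literature.Analysis.FunctionSpaces.SobolevDomainProofs`, and is
kept as a separate module next to it.

## Proof

Adams (1975), ¶6.26: a domain lying between two parallel hyperplanes at distance `d` satisfies,
for every `φ ∈ C_0^∞(Ω)`, `φ(x) = ∫_0^{x_n} (d/dt) φ(x', t) dt`, whence by Hölder and Fubini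
`‖φ‖_{0,p,Ω}^p ≤ (d^p / p) |φ|_{1,p,Ω}^p` (31), "and by completion" the estimate holds on
`W_0^{m,p}(Ω)`; "Inequality (31) is often called Poincaré's inequality". A bounded `Ω` has finite
width in every direction. Here:

* *smooth case* (`eLpNorm_le_mul_eLpNorm_fderiv_of_tsupport_subset_closedBall`): for `φ ∈ C¹`
  with `tsupport φ ⊆ closedBall 0 ρ` and a unit vector `v`, the fundamental theorem of calculus
  along `t ↦ x + t v` (Mathlib's `HasCompactSupport.enorm_le_lintegral_Ici_deriv`) gives
  `‖φ x‖ ≤ ∫_{[-2ρ, 0]} ‖Dφ (x + t v)‖ dt` (`enorm_le_lintegral_fderiv_line`); Hölder on the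
  interval of length `2ρ`, integration in `x`, Tonelli and translation invariance of the Haar
  measure `μ` give `‖φ‖_{L^p(μ)} ≤ 2ρ ‖Dφ‖_{L^p(μ)}` (constant `d = 2ρ` in place of `d p^{-1/p}`);
  for `p = ∞` the pointwise bound and `‖Dφ y‖ ≤ ‖Dφ‖_{L^∞}` (continuity, `μ` positive on open
  sets) suffice;
* *completion* (`poincare_inequality_holds`): if `φₙ` are test functions on `Ω` with
  `‖f - φₙ‖_{W^{1,p}(Ω)} → 0` and `g` is a weak derivative of `f`, then `g - Dφₙ` is a weak
  derivative of `f - φₙ` (`HasWeakFDerivOn.sub`, `HasWeakFDerivOn.of_contDiff_holds`), a.e. equal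
  on `Ω` to any other (`HasWeakFDerivOn.unique_holds`), so the infimum in `eSobolevDomainNorm 1`
  is attained at it and `Σᵢ ‖(g - Dφₙ) eᵢ‖_{L^p(Ω)} → 0`; the operator norm is controlled by the
  values on the basis `(eᵢ)` (`Module.Basis.opNorm_le`), so `‖g - Dφₙ‖_{L^p(Ω)} → 0`, and
  `‖f‖_p ≤ ‖f - φₙ‖_p + 2ρ (‖g‖_p + ‖g - Dφₙ‖_p)` passes to the limit.

## References

* L. C. Evans, *Partial Differential Equations*, 2nd ed., Graduate Studies in Mathematics 19,
  AMS (2010), §5.6.1, Theorem 3 (Poincaré inequality on `W₀^{1,p}(U)`, `U` bounded).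
* R. A. Adams, *Sobolev Spaces* (1975), ¶6.26 "A domain `Ω ⊂ ℝⁿ` is said to have finite width
  if it lies between two parallel hyperplanes", inequality (31) "often called Poincaré's
  inequality", and its extension to `W_0^{m,p}(Ω)` by completion, p. 158.
* H. Brezis, *Functional Analysis, Sobolev Spaces and Partial Differential Equations* (2011),
  Cor. 9.19.
-/

noncomputable section

open MeasureTheory TopologicalSpace

/-! ## The Poincaré inequality for `C¹` functions supported in a ball -/

namespace Literature.Analysis.FunctionSpaces

section Smooth

open Filter ENNReal Set Metric
open scoped Topology NNReal

variable {E' : Type*} [NormedAddCommGroup E'] [NormedSpace ℝ E']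
variable {F : Type*} [NormedAddCommGroup F] [NormedSpace ℝ F]

/-- A continuous function is dominated pointwise by its essential supremum with respect to a
measure positive on nonempty open sets: `‖ψ y‖ₑ ≤ ess sup_μ ‖ψ‖ₑ` (the open set
`{z | ess sup ‖ψ‖ₑ < ‖ψ z‖ₑ}` is `μ`-null by `meas_essSup_lt`, hence empty). Used for the case
`p = ∞` of the smooth Poincaré inequality. [folklore] -/
private theorem enorm_le_eLpNormEssSup_of_continuous_poincareAux {X : Type*}
    [TopologicalSpace X]
    [MeasurableSpace X] {G : Type*} [NormedAddCommGroup G] {ψ : X → G} (hψ : Continuous ψ)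
    (μ : Measure X) [μ.IsOpenPosMeasure] (y : X) : ‖ψ y‖ₑ ≤ eLpNormEssSup ψ μ := by
  refine le_of_not_gt fun h => ?_
  have hU : IsOpen {z : X | eLpNormEssSup ψ μ < ‖ψ z‖ₑ} :=
    isOpen_lt continuous_const hψ.enorm
  have hpos := hU.measure_pos μ ⟨y, h⟩
  exact hpos.ne' (meas_essSup_lt (f := fun z => ‖ψ z‖ₑ) (μ := μ))

/-- **Fundamental theorem of calculus along a line.** For `φ ∈ C¹(E'; F)` with
`tsupport φ ⊆ closedBall 0 ρ` and a unit vector `v`,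
`‖φ x‖ ≤ ∫_{-2ρ}^0 ‖Dφ (x + t v)‖ dt`: the restriction `t ↦ φ (x + t v)` is `C¹` with compact
support, so `φ x = -∫_0^∞ …` resp. `‖φ x‖ₑ ≤ ∫_{(-∞, 0]} ‖(d/dt) φ (x + t v)‖ₑ dt` (Mathlib's
`HasCompactSupport.enorm_le_lintegral_Ici_deriv`), `‖(d/dt) φ(x + tv)‖ = ‖Dφ(x + tv) v‖ ≤
‖Dφ(x + tv)‖`, and the integrand vanishes for `t < -2ρ` (then `x + t v ∉ tsupport φ` when
`x ∈ tsupport φ`). This is the identity `φ(x) = ∫_0^{x_n} (d/dt) φ(x', t) dt` opening the proof of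
Adams, *Sobolev Spaces* (1975), ¶6.26. [folklore] -/
theorem enorm_le_lintegral_fderiv_line {φ : E' → F} (hφ : ContDiff ℝ 1 φ) {ρ : ℝ} (hρ : 0 ≤ ρ)
    (hsupp : tsupport φ ⊆ closedBall (0 : E') ρ) {v : E'} (hv : ‖v‖ = 1) (x : E') :
    ‖φ x‖ₑ ≤ ∫⁻ t in Icc (-(2 * ρ)) 0, ‖fderiv ℝ φ (x + t • v)‖ₑ := by
  by_cases hx : x ∈ tsupport φ
  swap
  · simp [image_eq_zero_of_notMem_tsupport hx]
  have hxρ : ‖x‖ ≤ ρ := by simpa using hsupp hx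
  -- the one-variable restriction
  set f : ℝ → F := fun t => φ (x + t • v) with hf_def
  have hγ : ∀ t : ℝ, HasDerivAt (fun t : ℝ => x + t • v) v t := fun t => by
    simpa using ((hasDerivAt_id t).smul_const v).const_add x
  have hfd : ∀ t, HasDerivAt f (fderiv ℝ φ (x + t • v) v) t := fun t =>
    (hφ.differentiable one_ne_zero (x + t • v)).hasFDerivAt.comp_hasDerivAt t (hγ t)
  have hf1 : ContDiff ℝ 1 f :=
    hφ.comp (contDiff_const.add (contDiff_id.smul contDiff_const))
  -- points of the line far from `x` are outside the support
  have hout : ∀ t : ℝ, ρ + ‖x‖ < |t| → x + t • v ∉ tsupport φ := by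
    intro t ht hmem
    have h1 : ‖x + t • v‖ ≤ ρ := by simpa using hsupp hmem
    have h2 : |t| ≤ ‖x + t • v‖ + ‖x‖ := by
      have := norm_sub_le (x + t • v) x
      simpa [norm_smul, hv] using this
    linarith
  have hf2 : HasCompactSupport f := by
    refine HasCompactSupport.intro (isCompact_Icc (a := -(ρ + ‖x‖)) (b := ρ + ‖x‖))
      fun t ht => show φ (x + t • v) = 0 from image_eq_zero_of_notMem_tsupport (hout t ?_)
    rcases lt_or_ge (ρ + ‖x‖) |t| with h | h
    · exact h
    · exact absurd (abs_le.1 h) (by simpa [mem_Icc] using ht)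
  have key := hf2.enorm_le_lintegral_Ici_deriv hf1 0
  have hf0 : f 0 = φ x := by simp [hf_def]
  rw [hf0] at key
  refine key.trans ?_
  -- compare the integrands and the domains
  have hderiv : ∀ t, deriv f t = fderiv ℝ φ (x + t • v) v := fun t => (hfd t).deriv
  have hbound : ∀ t, ‖deriv f t‖ₑ ≤ ‖fderiv ℝ φ (x + t • v)‖ₑ := fun t => by
    rw [hderiv]
    refine (ContinuousLinearMap.le_opENorm _ _).trans ?_
    simp [enorm_eq_nnnorm, hv, nnnorm]
  -- the integrand vanishes for `t < -2ρ`
  have hzero : ∀ t : ℝ, t < -(2 * ρ) → ‖fderiv ℝ φ (x + t • v)‖ₑ = 0 := by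
    intro t ht
    have : x + t • v ∉ tsupport φ := hout t (by rw [abs_of_neg (by linarith)]; linarith)
    rw [fderiv_of_notMem_tsupport ℝ this]; exact enorm_zero (E := E' →L[ℝ] F)
  calc ∫⁻ y in Iic (0 : ℝ), ‖deriv f y‖ₑ
      ≤ ∫⁻ y in Iic (0 : ℝ), ‖fderiv ℝ φ (x + y • v)‖ₑ := lintegral_mono fun t => hbound t
    _ = ∫⁻ y in Iic (0 : ℝ), (Ici (-(2 * ρ))).indicator
          (fun y => ‖fderiv ℝ φ (x + y • v)‖ₑ) y := by
        refine lintegral_congr fun y => ?_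
        by_cases hy : y ∈ Ici (-(2 * ρ))
        · rw [indicator_of_mem hy]
        · rw [indicator_of_notMem hy, hzero y (by simpa using hy)]
    _ = ∫⁻ t in Icc (-(2 * ρ)) 0, ‖fderiv ℝ φ (x + t • v)‖ₑ := by
        rw [lintegral_indicator measurableSet_Ici, Measure.restrict_restrict measurableSet_Ici,
          Ici_inter_Iic]

variable [MeasurableSpace E'] [BorelSpace E'] [FiniteDimensional ℝ E']

/-- **Poincaré inequality for `C¹` functions supported in a ball** (Adams, *Sobolev Spaces*
(1975), ¶6.26, inequality (31), p. 158: `‖φ‖_{0,p,Ω} ≤ (d^p/p)^{1/p} |φ|_{1,p,Ω}` for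
`φ ∈ C_0^∞(Ω)`, `Ω` of finite width `d`; here with the ball of radius `ρ`, width `d = 2ρ`, the
slightly weaker constant `d`, any additive Haar measure `μ`, and all `1 ≤ p ≤ ∞`):
`‖φ‖_{L^p(μ)} ≤ 2ρ ‖Dφ‖_{L^p(μ)}`, the derivative measured in the operator norm. From the line
bound `enorm_le_lintegral_fderiv_line`: for `p < ∞`, Hölder on the parameter interval of length
`2ρ` (`eLpNorm_le_eLpNorm_mul_rpow_measure_univ`), integration in `x`, Tonelli
(`lintegral_lintegral_swap`) and translation invariance (`lintegral_add_right_eq_self`); for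
`p = ∞`, the pointwise bound `‖Dφ y‖ₑ ≤ ‖Dφ‖_{L^∞(μ)}` (continuity of `Dφ`, and `μ` is positive on
nonempty open sets).
[cite: Adams1975, ¶6.26 inequality (31), p. 158 (case of smooth compactly supported functions)] -/
theorem eLpNorm_le_mul_eLpNorm_fderiv_of_tsupport_subset_closedBall (μ : Measure E')
    [μ.IsAddHaarMeasure] {φ : E' → F} (hφ : ContDiff ℝ 1 φ) {ρ : ℝ} (hρ : 0 < ρ)
    (hsupp : tsupport φ ⊆ closedBall (0 : E') ρ) {v : E'} (hv : ‖v‖ = 1) {p : ℝ≥0∞}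
    (hp : 1 ≤ p) :
    eLpNorm φ p μ ≤ ENNReal.ofReal (2 * ρ) * eLpNorm (fderiv ℝ φ) p μ := by
  set R : ℝ := 2 * ρ with hR
  have hR0 : 0 < R := by positivity
  set I : Set ℝ := Icc (-R) 0 with hI
  have hIvol : volume I = ENNReal.ofReal R := by
    rw [hI, Real.volume_Icc]; congr 1; ring
  have hφ'c : Continuous (fderiv ℝ φ) := hφ.continuous_fderiv one_ne_zero
  -- pointwise bound via Hölder on the interval
  have hpt : ∀ x, ‖φ x‖ₑ ≤ eLpNorm (fun t : ℝ => fderiv ℝ φ (x + t • v)) p (volume.restrict I) *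
      ENNReal.ofReal R ^ (1 - 1 / p.toReal) := by
    intro x
    have hline := enorm_le_lintegral_fderiv_line hφ hρ.le hsupp hv x
    have hmeas : AEStronglyMeasurable (fun t : ℝ => fderiv ℝ φ (x + t • v))
        (volume.restrict I) :=
      (hφ'c.comp (continuous_const.add (continuous_id.smul continuous_const))).aestronglyMeasurable
    have hH := eLpNorm_le_eLpNorm_mul_rpow_measure_univ hp hmeas
    rw [eLpNorm_one_eq_lintegral_enorm, Measure.restrict_apply_univ, hIvol, ENNReal.toReal_one,
      div_one] at hH
    exact hline.trans hH
  rcases eq_or_ne p ∞ with rfl | hptop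
  · -- `p = ∞`
    simp only [ENNReal.toReal_top, _root_.div_zero, sub_zero, ENNReal.rpow_one,
      eLpNorm_exponent_top] at hpt ⊢
    refine eLpNormEssSup_le_of_ae_enorm_bound (Eventually.of_forall fun x => ?_)
    refine (hpt x).trans ?_
    rw [mul_comm]
    gcongr
    exact eLpNormEssSup_le_of_ae_enorm_bound (Eventually.of_forall fun t =>
      enorm_le_eLpNormEssSup_of_continuous_poincareAux hφ'c μ _)
  · -- `1 ≤ p < ∞`
    have hp0 : p ≠ 0 := (zero_lt_one.trans_le hp).ne'
    set q := p.toReal with hq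
    have hq1 : 1 ≤ q := by
      rw [hq, ← ENNReal.toReal_one]; exact ENNReal.toReal_mono hptop hp
    have hq0 : 0 < q := one_pos.trans_le hq1
    rw [eLpNorm_eq_lintegral_rpow_enorm_toReal hp0 hptop,
      eLpNorm_eq_lintegral_rpow_enorm_toReal hp0 hptop]
    -- pointwise `q`-th power bound
    have hptq : ∀ x, ‖φ x‖ₑ ^ q ≤
        ENNReal.ofReal R ^ (q - 1) * ∫⁻ t in I, ‖fderiv ℝ φ (x + t • v)‖ₑ ^ q := by
      intro x
      calc ‖φ x‖ₑ ^ q ≤ (eLpNorm (fun t : ℝ => fderiv ℝ φ (x + t • v)) p (volume.restrict I) *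
            ENNReal.ofReal R ^ (1 - 1 / q)) ^ q := by gcongr; exact hpt x
        _ = ENNReal.ofReal R ^ (q - 1) * ∫⁻ t in I, ‖fderiv ℝ φ (x + t • v)‖ₑ ^ q := by
          rw [ENNReal.mul_rpow_of_nonneg _ _ hq0.le, eLpNorm_eq_eLpNorm' hp0 hptop,
            ← lintegral_rpow_enorm_eq_rpow_eLpNorm' hq0, ← ENNReal.rpow_mul, mul_comm]
          congr 2
          field_simp
    -- integrate, Tonelli, translation invariance
    have hmeas2 : AEMeasurable (Function.uncurry fun (x : E') (t : ℝ) =>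
        ‖fderiv ℝ φ (x + t • v)‖ₑ ^ q) (μ.prod (volume.restrict I)) := by
      refine (Continuous.measurable ?_).aemeasurable
      exact ENNReal.continuous_rpow_const.comp
        (hφ'c.comp (continuous_fst.add (continuous_snd.smul continuous_const))).enorm
    have hti : ∀ t : ℝ, ∫⁻ x, ‖fderiv ℝ φ (x + t • v)‖ₑ ^ q ∂μ = ∫⁻ x, ‖fderiv ℝ φ x‖ₑ ^ q ∂μ :=
      fun t => lintegral_add_right_eq_self (μ := μ) (fun y => ‖fderiv ℝ φ y‖ₑ ^ q) (t • v)
    have hRtop : ENNReal.ofReal R ^ (q - 1) ≠ ∞ :=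
      ENNReal.rpow_ne_top_of_nonneg (sub_nonneg.2 hq1) ENNReal.ofReal_ne_top
    calc (∫⁻ x, ‖φ x‖ₑ ^ q ∂μ) ^ (1 / q)
        ≤ (∫⁻ x, (ENNReal.ofReal R ^ (q - 1) * ∫⁻ t in I, ‖fderiv ℝ φ (x + t • v)‖ₑ ^ q) ∂μ) ^
            (1 / q) := by
          gcongr with x
          exact hptq x
      _ = (ENNReal.ofReal R ^ (q - 1) * (ENNReal.ofReal R * ∫⁻ x, ‖fderiv ℝ φ x‖ₑ ^ q ∂μ)) ^
            (1 / q) := by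
          rw [lintegral_const_mul' _ _ hRtop, lintegral_lintegral_swap hmeas2]
          simp only [hti]
          rw [setLIntegral_const, hIvol, mul_comm (∫⁻ x, ‖fderiv ℝ φ x‖ₑ ^ q ∂μ)]
      _ = ENNReal.ofReal R * (∫⁻ x, ‖fderiv ℝ φ x‖ₑ ^ q ∂μ) ^ (1 / q) := by
          rw [← mul_assoc]
          nth_rw 2 [← ENNReal.rpow_one (ENNReal.ofReal R)]
          rw [← ENNReal.rpow_add_of_nonneg _ _ (sub_nonneg.2 hq1) zero_le_one, sub_add_cancel,
            ENNReal.mul_rpow_of_nonneg _ _ (by positivity : (0 : ℝ) ≤ 1 / q), ← ENNReal.rpow_mul,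
            mul_one_div_cancel hq0.ne', ENNReal.rpow_one]

end Smooth

end Literature.Analysis.FunctionSpaces

/-! ## The Poincaré inequality on `W₀^{1,p}(Ω)` -/

namespace Literature.Analysis.FunctionSpaces

section Poincare

open Filter ENNReal Set Metric
open scoped Topology NNReal

variable {E' : Type*} [NormedAddCommGroup E'] [NormedSpace ℝ E']
variable {F : Type*} [NormedAddCommGroup F] [NormedSpace ℝ F]

/-- The `L^p` norm of an operator-valued map `G' : E' → (E' →L[ℝ] F)` is controlled by the `L^p`
norms of its values on a finite basis `b`: pointwise
`‖G' x‖ ≤ (#ι · ‖b.equivFunL‖) Σᵢ ‖G' x (b i)‖` (`Module.Basis.opNorm_le`), then monotonicity and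
the triangle inequality of `eLpNorm` (`1 ≤ p`). This compares the operator-norm form
`‖Df‖_{L^p}` with the "sum over partial derivatives" form `Σᵢ ‖∂ᵢ f‖_{L^p}` of the `W^{1,p}`
seminorm (Brezis, §9.1; Evans, *PDE*, §5.2.2, equivalent norms). [folklore] -/
theorem eLpNorm_le_card_mul_opNorm_mul_sum_eLpNorm_apply_basis [MeasurableSpace E'] {ι : Type*}
    [Fintype ι] (b : Module.Basis ι ℝ E') {G' : E' → E' →L[ℝ] F} {ν : Measure E'}
    (hG : AEStronglyMeasurable G' ν) {p : ℝ≥0∞} (hp : 1 ≤ p) :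
    eLpNorm G' p ν ≤ (Fintype.card ι • ‖(b.equivFunL : E' →L[ℝ] ι → ℝ)‖₊ : ℝ≥0) *
      ∑ i, eLpNorm (fun x => G' x (b i)) p ν := by
  set C : ℝ≥0 := Fintype.card ι • ‖(b.equivFunL : E' →L[ℝ] ι → ℝ)‖₊ with hC
  have hpt : ∀ x, ‖G' x‖ ≤ (C : ℝ) * ‖(∑ i, ‖G' x (b i)‖ : ℝ)‖ := fun x => by
    have hM : 0 ≤ ∑ i, ‖G' x (b i)‖ := Finset.sum_nonneg fun i _ => norm_nonneg _
    calc ‖G' x‖ ≤ (Fintype.card ι • ‖(b.equivFunL : E' →L[ℝ] ι → ℝ)‖) * ∑ i, ‖G' x (b i)‖ :=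
          b.opNorm_le hM fun i =>
            Finset.single_le_sum (fun j _ => norm_nonneg (G' x (b j))) (Finset.mem_univ i)
      _ = (C : ℝ) * ‖(∑ i, ‖G' x (b i)‖ : ℝ)‖ := by
          rw [Real.norm_of_nonneg hM, hC]
          push_cast
          ring
  have h1 := eLpNorm_le_mul_eLpNorm_of_ae_le_mul (Eventually.of_forall hpt) p (μ := ν)
  rw [ENNReal.ofReal_coe_nnreal] at h1
  refine h1.trans ?_
  gcongr
  have hfun : (fun x => ∑ i, ‖G' x (b i)‖) = ∑ i, fun x => ‖G' x (b i)‖ := by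
    ext x; simp
  rw [hfun]
  refine (eLpNorm_sum_le (fun i _ => ?_) hp).trans
    (le_of_eq <| Finset.sum_congr rfl fun i _ => eLpNorm_norm _)
  exact ((ContinuousLinearMap.apply ℝ F (b i)).continuous.comp_aestronglyMeasurable hG).norm

variable [MeasurableSpace E'] [FiniteDimensional ℝ E']

/-- **Discharge of `poincare_inequality`: the Poincaré inequality on `W₀^{1,p}(Ω)`.** For a
bounded open `Ω` in a finite-dimensional real normed space of positive dimension, `1 ≤ p ≤ ∞`, an
additive Haar measure `μ` and a complete `F`: with `Ω ⊆ closedBall 0 ρ` and `C := 2ρ`, every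
`f ∈ W₀^{1,p}(Ω; F)` with weak derivative `g` satisfies `‖f‖_{L^p(Ω)} ≤ C ‖g‖_{L^p(Ω)}`
(Evans, *PDE*, §5.6.1, Theorem 3, the estimate `‖u‖_{L^p(U)} ≤ C ‖Du‖_{L^p(U)}` for
`u ∈ W₀^{1,p}(U)`, `U` bounded, "sometimes called Poincaré's inequality"; Brezis, Cor. 9.19).
The proof is that of Adams, *Sobolev Spaces* (1975), ¶6.26, p. 158 (domains of finite width,
inequality (31), extended to `W_0^{m,p}(Ω)` "by completion"): (1) for the approximating test
functions `φₙ` on `Ω`, `‖φₙ‖_{L^p(Ω)} ≤ 2ρ ‖Dφₙ‖_{L^p(Ω)}`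
(`eLpNorm_le_mul_eLpNorm_fderiv_of_tsupport_subset_closedBall`; `Dφₙ` vanishes off `Ω`);
(2) `g - Dφₙ` is a weak derivative of `f - φₙ` (`HasWeakFDerivOn.sub`, `of_contDiff_holds`),
a.e. equal on `Ω` to every other one (`unique_holds`), so the infimum in `eSobolevDomainNorm 1`
equals `Σᵢ ‖(g - Dφₙ) eᵢ‖_{L^p(Ω)} ≤ ‖f - φₙ‖_{W^{1,p}(Ω)}` and hence
`‖g - Dφₙ‖_{L^p(Ω)} ≤ C_b ‖f - φₙ‖_{W^{1,p}(Ω)}`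
(`eLpNorm_le_card_mul_opNorm_mul_sum_eLpNorm_apply_basis`);
(3) `‖f‖_p ≤ ‖f - φₙ‖_p + 2ρ (‖g‖_p + ‖g - Dφₙ‖_p)` for every `n`, and `n → ∞`.
[cite: Evans2010, §5.6.1 Theorem 3] [cite: Adams1975, ¶6.26 inequality (31) and its extension by completion to W_0, p. 158 (Poincaré inequality on domains of finite width)] [cite: Brezis2011, Cor. 9.19] -/
theorem poincare_inequality_holds : poincare_inequality (E' := E') (F := F) := by
  intro _ _ _ Ω hΩ p hp μ _
  -- a ball around `0` containing `Ω`, and a unit vector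
  obtain ⟨ρ, hρ, hΩρ⟩ := hΩ.subset_closedBall_lt 0 (0 : E')
  obtain ⟨v, hv⟩ : ∃ v : E', ‖v‖ = 1 := exists_norm_eq E' zero_le_one
  set b := Module.finBasis ℝ E' with hb
  set Cb : ℝ≥0 := Fintype.card (Fin (Module.finrank ℝ E')) •
    ‖(b.equivFunL : E' →L[ℝ] Fin (Module.finrank ℝ E') → ℝ)‖₊ with hCb
  refine ⟨(2 * ρ).toNNReal, fun f g hf hg => ?_⟩
  obtain ⟨hf1, φ, hφ, hlim⟩ := hf
  have hφ1 : ∀ n, ContDiff ℝ 1 (φ n) := fun n => (hφ n).contDiff.of_le (by simp)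
  have hDφ : ∀ n, HasWeakFDerivOn Ω μ (φ n) (fderiv ℝ (φ n)) := fun n =>
    HasWeakFDerivOn.of_contDiff_holds Ω μ (hφ1 n)
  have hDφc : ∀ n, Continuous (fderiv ℝ (φ n)) := fun n =>
    (hφ1 n).continuous_fderiv one_ne_zero
  -- (1) the `L^p` part of the `W^{1,p}` norm
  have h1 : ∀ n, eLpNorm (f - φ n) p (μ.restrict Ω) ≤ eSobolevDomainNorm 1 p Ω μ (f - φ n) :=
    fun n => eLpNorm_le_eSobolevDomainNorm
  -- (2) the derivative part: by uniqueness the infimum is over `g - Dφₙ` only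
  have h2 : ∀ n, ∑ i, eLpNorm (fun x => (g - fderiv ℝ (φ n)) x (b i)) p (μ.restrict Ω) ≤
      eSobolevDomainNorm 1 p Ω μ (f - φ n) := by
    intro n
    have hsub : HasWeakFDerivOn Ω μ (f - φ n) (g - fderiv ℝ (φ n)) := hg.sub (hDφ n)
    simp only [eSobolevDomainNorm]
    refine le_add_left (le_iInf₂ fun g' hg' => le_of_eq <| Finset.sum_congr rfl fun i _ => ?_)
    refine eLpNorm_congr_ae ?_
    filter_upwards [HasWeakFDerivOn.unique_holds hsub hg'] with x hx
    rw [hx]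
  -- (3) hence `‖g - Dφₙ‖_{L^p(Ω)} ≤ C_b ‖f - φₙ‖_{W^{1,p}(Ω)}`
  have hgm : AEStronglyMeasurable g (μ.restrict Ω) :=
    hg.locallyIntegrableOn_deriv.aestronglyMeasurable
  have h3 : ∀ n, eLpNorm (g - fderiv ℝ (φ n)) p (μ.restrict Ω) ≤
      Cb * eSobolevDomainNorm 1 p Ω μ (f - φ n) := fun n => by
    have hm : AEStronglyMeasurable (g - fderiv ℝ (φ n)) (μ.restrict Ω) :=
      hgm.sub (hDφc n).aestronglyMeasurable
    refine (eLpNorm_le_card_mul_opNorm_mul_sum_eLpNorm_apply_basis b hm hp).trans ?_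
    gcongr
    exact h2 n
  -- (4) the smooth Poincaré inequality for `φₙ`, transported to `μ|_Ω`
  have h4 : ∀ n, eLpNorm (φ n) p (μ.restrict Ω) ≤
      ENNReal.ofReal (2 * ρ) * eLpNorm (fderiv ℝ (φ n)) p (μ.restrict Ω) := by
    intro n
    have hsupp : tsupport (φ n) ⊆ closedBall (0 : E') ρ := (hφ n).tsupport_subset.trans hΩρ
    have hsuppD : Function.support (fderiv ℝ (φ n)) ⊆ (Ω : Set E') :=
      (support_fderiv_subset ℝ).trans (hφ n).tsupport_subset
    calc eLpNorm (φ n) p (μ.restrict Ω) ≤ eLpNorm (φ n) p μ :=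
          eLpNorm_mono_measure _ Measure.restrict_le_self
      _ ≤ ENNReal.ofReal (2 * ρ) * eLpNorm (fderiv ℝ (φ n)) p μ :=
          eLpNorm_le_mul_eLpNorm_fderiv_of_tsupport_subset_closedBall μ (hφ1 n) hρ hsupp hv hp
      _ = ENNReal.ofReal (2 * ρ) * eLpNorm (fderiv ℝ (φ n)) p (μ.restrict Ω) := by
          rw [eLpNorm_restrict_eq_of_support_subset (ε := E' →L[ℝ] F) hsuppD]
  -- (5) combine: a bound valid for every `n`
  have hfm : AEStronglyMeasurable f (μ.restrict Ω) := hf1.memLp.aestronglyMeasurable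
  have h5 : ∀ n, eLpNorm f p (μ.restrict Ω) ≤ eSobolevDomainNorm 1 p Ω μ (f - φ n) +
      ENNReal.ofReal (2 * ρ) * (eLpNorm g p (μ.restrict Ω) +
        Cb * eSobolevDomainNorm 1 p Ω μ (f - φ n)) := by
    intro n
    have hφm : AEStronglyMeasurable (φ n) (μ.restrict Ω) :=
      (hφ n).contDiff.continuous.aestronglyMeasurable
    have hDφm : AEStronglyMeasurable (fderiv ℝ (φ n)) (μ.restrict Ω) :=
      (hDφc n).aestronglyMeasurable
    calc eLpNorm f p (μ.restrict Ω) = eLpNorm ((f - φ n) + φ n) p (μ.restrict Ω) := by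
          rw [sub_add_cancel]
      _ ≤ eLpNorm (f - φ n) p (μ.restrict Ω) + eLpNorm (φ n) p (μ.restrict Ω) :=
          eLpNorm_add_le (hfm.sub hφm) hφm hp
      _ ≤ eSobolevDomainNorm 1 p Ω μ (f - φ n) +
            ENNReal.ofReal (2 * ρ) * eLpNorm (fderiv ℝ (φ n)) p (μ.restrict Ω) :=
          add_le_add (h1 n) (h4 n)
      _ ≤ _ := by
          gcongr
          calc eLpNorm (fderiv ℝ (φ n)) p (μ.restrict Ω)
              = eLpNorm (g - (g - fderiv ℝ (φ n))) p (μ.restrict Ω) := by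
                rw [_root_.sub_sub_cancel]
            _ ≤ eLpNorm g p (μ.restrict Ω) + eLpNorm (g - fderiv ℝ (φ n)) p (μ.restrict Ω) :=
                eLpNorm_sub_le hgm (hgm.sub hDφm) hp
            _ ≤ _ := by gcongr; exact h3 n
  -- (6) let `n → ∞`
  have hlim' := hlim.add (ENNReal.Tendsto.const_mul (a := ENNReal.ofReal (2 * ρ))
    ((tendsto_const_nhds (x := eLpNorm g p (μ.restrict Ω))).add
      (ENNReal.Tendsto.const_mul (a := (Cb : ℝ≥0∞)) hlim (Or.inr ENNReal.coe_ne_top)))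
    (Or.inr ENNReal.ofReal_ne_top))
  rw [zero_add, mul_zero, add_zero] at hlim'
  exact ge_of_tendsto' hlim' h5

end Poincare

end Literature.Analysis.FunctionSpaces
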